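import Summits.QuantumFields.GaugeBoot.TiltedBoxEvenMidAxisWitness
import Summits.QuantumFields.GaugeBoot.TiltedBoxSquareSlabStep
import Summits.QuantumFields.GaugeBoot.TiltedBoxOddAxisGaugeGroups
import HarnessLib

/-!
# In-plane LINK reflection positivity FAILS on the square tilted box of EVEN side, `d ≥ 3`, every `β > 0` (gauge-boot, L3 negative supplement)

HONEST FRAMING (cell `pub-gaugeboot`, page 1 of every file): the venture produces certified bounds
on lattice expectations at stated coupling, gauge group, dimension and torus size; NOT a mass gap,
NOT a continuum limit, NOT a string tension; NOT Yang–Mills-summit-bearing (barriers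
`FixedCouplingUltralocality`, `PerturbativeInvisibility`). This module is a small NEGATIVE result
about which positivity blocks a certificate on the tilted box may use; it discharges nothing else.

The in-plane mirrors `x_i ↦ c - x_i` of the square tilted box `ℤ^d/Γ(M, M, L)` (FILS's periodic
box with sides at 45°, taken "at the cost of losing the other RP") come in four types (side `M`
even/odd; `c` even/odd = site/link mirror). In the tree: even side, site mirror
(`not_tiltedBox_axisRP`: twisted LAYER, every real `β`); odd side, site mirror
(`not_tiltedBox_axisRP_odd`: twisted SLAB, `β > 0`, `d ≥ 3`); odd side, link mirror
(`not_tiltedBox_midAxisRP_odd`: twisted LAYER at `P + 1`, the mechanism of the first, every real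
`β`). This file settles the fourth: EVEN side `M = 2P`, LINK mirror `x_i ↦ 1 - x_i`
(`Θ = configMidReflect e i Θ_i`, the Osterwalder–Seiler mid-plane reflection attached to the flip
`Θ_i`; a symmetry of `μ_β`, `IsAxisFlip.integral_comp_configMidReflect_gibbs_complex`), closed
half `{1 ≤ x_i ≤ P}` — the shape in which `tiltedBox_linkRP` HOLDS along every axis `k ∉ {i, j}`.
Along `i` it FAILS: the slab at `½` is reflected exactly but the slab at `P + ½` is TWISTED by
`T = [2P e_j]` (`TiltedBoxEvenMidAxisGeometry.lean`); the twisted-slab mechanism of the odd box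
applies verbatim, the exact slab riding along as a frozen positive factor
`B = ∏_{slab ½} e^{-β(N - Re tr ρ)}`:

  `∫ conj F(ΘU) F(U) dμ_β = -(C₀/Z) · z^{n-4} c_β⁴ · ∫ B · (W_p - W_{p+T})² dμ₀ < 0`

for the half observable `F = (W_p - W_{p+T}) · exp(β ∑_q c_q (N - Re tr ρ(U_q)))` of
`TiltedBoxEvenMidAxisWitness.lean` (`p` a transverse plaquette of the layer `P`; slab step
`SquareSlab.slab_step`; `c_β > 0` the scalar of `∫ e^{β Re tr ρ} ρ`, `TwistedSlabHaar.lean`).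

* **`tiltedBox_midAxisRP_neg`** / **`not_tiltedBox_midAxisRP`**: on `ℤ^d/Γ(2P, 2P, L)`, `P ≥ 2`,
  `L ≥ 2`, `d ≥ 3` (a direction `k ∉ {i, j}`), `i ≠ j`, for compact second countable `G`,
  continuous `ρ` with scalar commutant, `N ≥ 1`, `ρ` non-trivial and EVERY `β > 0`, closed-half
  link RP along `i` in the shape of `tiltedBox_linkRP` FAILS;
* **`not_tiltedBox_midAxisRP_suN`** (`N ≥ 2`) / **`not_tiltedBox_midAxisRP_uN`** (`N ≥ 1`): the
  venture's gauge groups (scalar commutant by `hasScalarCommutant_fundamentalRep`).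

(At `β = 0` the pairing is `|E F|² ≥ 0`, so `β > 0` is needed; `P = 1` is excluded: both slabs
would meet the same two layers.) With the earlier files: NO in-plane mirror of a square tilted box of
side `≥ 3`, through sites or links, is of positive type in `d ≥ 3`; the in-plane flips enter a
tilted-box SDP only as symmetries. In `d = 2` the mirror IS positive, every real `β`
(`TiltedBoxEvenMidAxisRPTwoDim.lean`, `tiltedBox_midAxisRP_twoDim`). Small new negative; folklore mechanism.

References: J. Fröhlich, R. Israel, E. H. Lieb, B. Simon, J. Stat. Phys. 22 (1980) 297, §3;
K. Osterwalder, E. Seiler, Ann. Phys. 110 (1978) 440, §2; E. Seiler, LNP 159 (1982);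
M. Biskup, in LNM 1970 (2009) §5.5; V. Kazakov, Z. Zheng, arXiv:2203.11360 §3.1 (link reflections).
-/

noncomputable section

open MeasureTheory QuotientAddGroup
open scoped ComplexOrder ComplexConjugate
open Literature.MathematicalPhysics.QuantumFieldTheory (haarProbability)
open Literature.RepresentationTheory.CompactGroups
open Literature.MathematicalPhysics.QuantumLattice

namespace Summit.QuantumFields.GaugeBoot

namespace TiltedRP

section Main

variable {d : ℕ} {i j : Fin d} {L P N : ℕ} [NeZero L] [NeZero P]
variable {G : Type*} [Group G] [TopologicalSpace G] [IsTopologicalGroup G] [CompactSpace G]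
  [MeasurableSpace G] [BorelSpace G] [SecondCountableTopology G]
variable (ρ : G →* Matrix (Fin N) (Fin N) ℂ) (q : DirPair d)

/-- The two slabs are disjoint: no plaquette is based both in the layer `0` and in the layer `P`
(`P ≢ 0 mod 2P` for `P ≥ 2`). [folklore] -/
theorem disjoint_slab_zero_slab_half (hP : 2 ≤ P) :
    Disjoint (Finset.univ.filter (SquareSlab.IsSlabPlaq (d := d) (i := i) (j := j) (L := L) (0 : ZMod (2 * P))))
      (Finset.univ.filter (SquareSlab.IsSlabPlaq ((P : ℕ) : ZMod (2 * P)))) := by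
  rw [Finset.disjoint_filter]
  intro p _ h0 hP'
  have h := h0.2.symm.trans hP'.2
  have h' := congrArg ZMod.val h
  rw [ZMod.val_zero, val_natCast_self hP] at h'
  omega

/-- **In-plane link reflection positivity FAILS on the square tilted box of even side, `β > 0`.**
Box `ℤ^d/Γ(2P, 2P, L)` (`P ≥ 2`, `L ≥ 1`, `i ≠ j`), `Θ = configMidReflect … i (tiltedAxisFlip …)`
(`x_i ↦ 1 - x_i`; crossing `i`-links reversed and inverted), closed half `{1 ≤ x_i ≤ P (mod 2P)}`
(`axisCoord`); `q = (a, b)` transverse (`a, b ≠ i`, `e_a, e_b ≠ 0`); `G` compact second countable,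
`ρ` continuous, non-trivial, with scalar commutant, `N ≥ 1`, `β > 0`: a bounded measurable half
observable `F` (`IsMidObservable`) has `∫ conj F(ΘU) · F(U) dμ_β < 0`. -/
theorem tiltedBox_midAxisRP_neg (hP : 2 ≤ P) (hij : i ≠ j) (hq1 : q.1.1 ≠ i) (hq2 : q.1.2 ≠ i)
    (he1 : tiltedUnit d i j (2 * P) (2 * P) L q.1.1 ≠ 0)
    (he2 : tiltedUnit d i j (2 * P) (2 * P) L q.1.2 ≠ 0)
    (hρ : Continuous ρ) (hirr : TwistedSlab.HasScalarCommutant ρ) (hN : 1 ≤ N) (hρ1 : ∃ g, ρ g ≠ 1)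
    {β : ℝ} (hβ : 0 < β) :
    ∃ F : Config (TiltedSite d i j (2 * P) (2 * P) L) d G → ℂ, Measurable F ∧
      (∃ C : ℝ, ∀ U, ‖F U‖ ≤ C) ∧
      IsMidObservable (tiltedUnit d i j (2 * P) (2 * P) L) P (axisCoord d L (2 * P)) F ∧
      ∫ U, conj (F (configMidReflect (tiltedUnit d i j (2 * P) (2 * P) L) i
          (tiltedAxisFlip d L (2 * P) hij) U)) * F U
        ∂(gibbs ρ (tiltedUnit d i j (2 * P) (2 * P) L) β) < 0 := by
  classical
  haveI : Fact (1 < 2 * P) := ⟨by omega⟩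
  refine ⟨fun U => midF ρ q β U, (continuous_midF ρ q hρ β).measurable, exists_norm_midF_le ρ q hρ β,
    isMidObservable_midF ρ q hP hij hq1 hq2 β, ?_⟩
  haveI := TwistedSlab.isProbabilityMeasure_productHaar' (A := TiltedSite d i j (2 * P) (2 * P) L) (d := d) (G := G)
  -- the constants (`e = tiltedUnit`, `y₀ = layerSite`, `T = tiltedTwist`, block = `SquareSlab.block … P`)
  obtain ⟨c, hcpos, hc⟩ := TwistedSlab.wAvg_wilsonWeight_eq_smul_pos ρ hirr hρ hβ hN
  have hzr : ∫ k, (TwistedSlab.wilsonWeight ρ β k : ℂ) ∂(haarProbability G) =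
      ((∫ k, TwistedSlab.wilsonWeight ρ β k ∂(haarProbability G) : ℝ) : ℂ) := integral_complex_ofReal
  have hzpos : 0 < ∫ k, TwistedSlab.wilsonWeight ρ β k ∂(haarProbability G) := by
    have hint : Integrable (TwistedSlab.wilsonWeight ρ β) (haarProbability G) :=
      (TwistedSlab.continuous_wilsonWeight ρ hρ β).integrable_of_hasCompactSupport (HasCompactSupport.of_compactSpace _)
    rw [integral_pos_iff_support_of_nonneg (fun k => (TwistedSlab.wilsonWeight_pos ρ β k).le) hint]
    have : Function.support (TwistedSlab.wilsonWeight ρ β) = Set.univ :=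
      Set.eq_univ_of_forall fun k => (TwistedSlab.wilsonWeight_pos ρ β k).ne'
    rw [this, measure_univ]; exact one_pos
  have hZ := normaliser_pos (A := TiltedSite d i j (2 * P) (2 * P) L) (G := G) ρ hρ (tiltedUnit d i j (2 * P) (2 * P) L) β
  set Z := ∫ U, Real.exp (-β * wilsonAction ρ (tiltedUnit d i j (2 * P) (2 * P) L) U)
    ∂(productHaar (TiltedSite d i j (2 * P) (2 * P) L) d G) with hZdef
  set C₀ : ℝ := ∏ _p ∈ Finset.univ.filter (SquareSlab.IsSlabPlaq (d := d) (i := i) (j := j) (L := L) ((P : ℕ) : ZMod (2 * P))),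
    Real.exp (-(β * N)) with hC₀
  have hC₀pos : 0 < C₀ := Finset.prod_pos fun _ _ => Real.exp_pos _
  have hsq := integral_midLower_mul_midDiff_sq_pos ρ q hij hq2 he2 hρ hρ1 β (L := L)
  -- Step A: the integrand against the product Haar measure
  have hsplit : ∀ U : Config (TiltedSite d i j (2 * P) (2 * P) L) d G,
      ∑ p ∈ Finset.univ.filter (fun p => SquareSlab.IsSlabPlaq (0 : ZMod (2 * P)) p ∨
          SquareSlab.IsSlabPlaq ((P : ℕ) : ZMod (2 * P)) p),
        ((N : ℝ) - plaqObs ρ (tiltedUnit d i j (2 * P) (2 * P) L) p U) =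
      (∑ p ∈ Finset.univ.filter (SquareSlab.IsSlabPlaq (0 : ZMod (2 * P))),
        ((N : ℝ) - plaqObs ρ (tiltedUnit d i j (2 * P) (2 * P) L) p U)) +
      ∑ p ∈ Finset.univ.filter (SquareSlab.IsSlabPlaq ((P : ℕ) : ZMod (2 * P))),
        ((N : ℝ) - plaqObs ρ (tiltedUnit d i j (2 * P) (2 * P) L) p U) := fun U => by
    rw [Finset.filter_or, Finset.sum_union (disjoint_slab_zero_slab_half hP)]
  have hlow : ∀ U : Config (TiltedSite d i j (2 * P) (2 * P) L) d G,
      Real.exp (-(β * ∑ p ∈ Finset.univ.filter (SquareSlab.IsSlabPlaq (0 : ZMod (2 * P))),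
        ((N : ℝ) - plaqObs ρ (tiltedUnit d i j (2 * P) (2 * P) L) p U))) = midLower ρ β U := fun U => by
    rw [midLower, Finset.mul_sum, ← Finset.sum_neg_distrib, Real.exp_sum]
  have hupper : ∀ U : Config (TiltedSite d i j (2 * P) (2 * P) L) d G,
      Real.exp (-(β * ∑ p ∈ Finset.univ.filter (SquareSlab.IsSlabPlaq ((P : ℕ) : ZMod (2 * P))),
        ((N : ℝ) - plaqObs ρ (tiltedUnit d i j (2 * P) (2 * P) L) p U))) =
      C₀ * ∏ t ∈ SquareSlab.block d i j L (2 * P) ((P : ℕ) : ZMod (2 * P)),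
        TwistedSlab.wilsonWeight ρ β (SquareSlab.frozenA ((P : ℕ) : ZMod (2 * P)) t U * (U t)⁻¹ *
          SquareSlab.frozenB ((P : ℕ) : ZMod (2 * P)) t U) := fun U => by
    rw [← SquareSlab.prod_exp_slab_eq ρ hρ β _ U, hC₀, ← Finset.prod_mul_distrib, Finset.mul_sum,
      ← Finset.sum_neg_distrib, Real.exp_sum]
    refine Finset.prod_congr rfl fun p _ => ?_
    rw [← Real.exp_add]; congr 1; ring
  have hreal : ∀ U : Config (TiltedSite d i j (2 * P) (2 * P) L) d G,
      Real.exp (-β * wilsonAction ρ (tiltedUnit d i j (2 * P) (2 * P) L) U) / Z *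
        (Real.exp (β * midExpo ρ (configMidReflect (tiltedUnit d i j (2 * P) (2 * P) L) i
          (tiltedAxisFlip d L (2 * P) hij) U)) * Real.exp (β * midExpo ρ U)) =
      C₀ / Z * (midLower ρ β U * ∏ t ∈ SquareSlab.block d i j L (2 * P) ((P : ℕ) : ZMod (2 * P)),
        TwistedSlab.wilsonWeight ρ β (SquareSlab.frozenA ((P : ℕ) : ZMod (2 * P)) t U * (U t)⁻¹ *
          SquareSlab.frozenB ((P : ℕ) : ZMod (2 * P)) t U)) := by
    intro U
    have hexp : Real.exp (-β * wilsonAction ρ (tiltedUnit d i j (2 * P) (2 * P) L) U) *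
        (Real.exp (β * midExpo ρ (configMidReflect (tiltedUnit d i j (2 * P) (2 * P) L) i
          (tiltedAxisFlip d L (2 * P) hij) U)) * Real.exp (β * midExpo ρ U)) =
        C₀ * (midLower ρ β U * ∏ t ∈ SquareSlab.block d i j L (2 * P) ((P : ℕ) : ZMod (2 * P)),
          TwistedSlab.wilsonWeight ρ β (SquareSlab.frozenA ((P : ℕ) : ZMod (2 * P)) t U * (U t)⁻¹ *
            SquareSlab.frozenB ((P : ℕ) : ZMod (2 * P)) t U)) := by
      rw [← Real.exp_add, ← Real.exp_add,
        show -β * wilsonAction ρ (tiltedUnit d i j (2 * P) (2 * P) L) U +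
          (β * midExpo ρ (configMidReflect (tiltedUnit d i j (2 * P) (2 * P) L) i
            (tiltedAxisFlip d L (2 * P) hij) U) + β * midExpo ρ U) =
          β * (midExpo ρ (configMidReflect (tiltedUnit d i j (2 * P) (2 * P) L) i
            (tiltedAxisFlip d L (2 * P) hij) U) + midExpo ρ U -
            wilsonAction ρ (tiltedUnit d i j (2 * P) (2 * P) L) U) by ring,
        midExpo_configMidReflect_add ρ hP hij hρ U, hsplit U, mul_neg, mul_add, neg_add, Real.exp_add, hlow U,
        hupper U]
      ring
    rw [div_mul_eq_mul_div, hexp, mul_div_right_comm]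
  have hA : ∫ U, conj (midF ρ q β (configMidReflect (tiltedUnit d i j (2 * P) (2 * P) L) i
        (tiltedAxisFlip d L (2 * P) hij) U)) * midF ρ q β U
        ∂(gibbs ρ (tiltedUnit d i j (2 * P) (2 * P) L) β) =
      ((C₀ / Z : ℝ) : ℂ) * ∫ U, ((midDiff ρ q (configMidReflect (tiltedUnit d i j (2 * P) (2 * P) L) i
          (tiltedAxisFlip d L (2 * P) hij) U) : ℝ) : ℂ) * ((midDiff ρ q U : ℝ) : ℂ) *
          (((midLower ρ β U : ℝ) : ℂ) * ∏ t ∈ SquareSlab.block d i j L (2 * P) ((P : ℕ) : ZMod (2 * P)),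
            (TwistedSlab.wilsonWeight ρ β (SquareSlab.frozenA ((P : ℕ) : ZMod (2 * P)) t U * (U t)⁻¹ *
              SquareSlab.frozenB ((P : ℕ) : ZMod (2 * P)) t U) : ℂ))
          ∂(productHaar (TiltedSite d i j (2 * P) (2 * P) L) d G) := by
    rw [integral_gibbs, ← integral_const_mul]
    refine integral_congr_ae (ae_of_all _ fun U => ?_)
    have h := congrArg (fun r : ℝ => (r : ℂ)) (hreal U)
    push_cast at h
    simp only [midF, map_mul, Complex.conj_ofReal, Complex.real_smul]
    push_cast
    linear_combination (((midDiff ρ q (configMidReflect (tiltedUnit d i j (2 * P) (2 * P) L) i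
      (tiltedAxisFlip d L (2 * P) hij) U) : ℝ) : ℂ) * ((midDiff ρ q U : ℝ) : ℂ)) * h
  -- Step B: expand the differences and transfer the plaquettes above the twisted slab down,
  -- the exact slab `midLower` riding along as a frozen factor
  have hx0 : axisCoord d L (2 * P) (layerSite d L P : TiltedSite d i j (2 * P) (2 * P) L) = ((P : ℕ) : ZMod (2 * P)) :=
    axisCoord_layerSite
  have hxT := axisCoord_layerSite_add_twist (d := d) (L := L) (P := P) hij
  -- continuity, dependence and integrability of the pieces
  have hWc : ∀ x, Continuous fun U : Config (TiltedSite d i j (2 * P) (2 * P) L) d G =>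
      ((plaqObs ρ (tiltedUnit d i j (2 * P) (2 * P) L) (x, q) U : ℝ) : ℂ) :=
    fun x => SquareSlab.continuous_plaqObs_complex ρ hρ (x, q)
  have hfc : ∀ x, Continuous fun U : Config (TiltedSite d i j (2 * P) (2 * P) L) d G =>
      ((plaqObs ρ (tiltedUnit d i j (2 * P) (2 * P) L) (x, q) U : ℝ) : ℂ) * ((midLower ρ β U : ℝ) : ℂ) :=
    fun x => (hWc x).mul (Complex.continuous_ofReal.comp (continuous_midLower ρ hρ β))
  have hfdep : ∀ x, axisCoord d L (2 * P) x = ((P : ℕ) : ZMod (2 * P)) →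
      DependsOn (fun U : Config (TiltedSite d i j (2 * P) (2 * P) L) d G =>
        ((plaqObs ρ (tiltedUnit d i j (2 * P) (2 * P) L) (x, q) U : ℝ) : ℂ) * ((midLower ρ β U : ℝ) : ℂ))
        (((SquareSlab.block d i j L (2 * P) ((P : ℕ) : ZMod (2 * P)))ᶜ : Finset _) : Set _) := by
    intro x hx U V hUV
    have h1 := SquareSlab.dependsOn_plaqObs_layer (G := G) ρ (x, q) hx hq1 hq2 hUV
    have h2 := dependsOn_midLower (G := G) ρ hP β hUV
    dsimp only at h1 h2 ⊢
    rw [h1, h2]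
  have hPc := SquareSlab.continuous_slabProd (i := i) (j := j) (L := L) (M := 2 * P) ρ hρ β ((P : ℕ) : ZMod (2 * P))
  have hI3 : ∀ x y, Integrable (fun U : Config (TiltedSite d i j (2 * P) (2 * P) L) d G =>
      ((plaqObs ρ (tiltedUnit d i j (2 * P) (2 * P) L) (x, q) U : ℝ) : ℂ) * ((midLower ρ β U : ℝ) : ℂ) *
      ((plaqObs ρ (tiltedUnit d i j (2 * P) (2 * P) L) (y, q) U : ℝ) : ℂ) *
      ∏ t ∈ SquareSlab.block d i j L (2 * P) ((P : ℕ) : ZMod (2 * P)),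
        (TwistedSlab.wilsonWeight ρ β (SquareSlab.frozenA ((P : ℕ) : ZMod (2 * P)) t U * (U t)⁻¹ *
          SquareSlab.frozenB ((P : ℕ) : ZMod (2 * P)) t U) : ℂ))
      (productHaar (TiltedSite d i j (2 * P) (2 * P) L) d G) :=
    fun x y => TwistedSlab.integrable_config_of_continuous (((hfc x).mul (hWc y)).mul hPc)
  have hI2 : ∀ x y, Integrable (fun U : Config (TiltedSite d i j (2 * P) (2 * P) L) d G =>
      ((plaqObs ρ (tiltedUnit d i j (2 * P) (2 * P) L) (x, q) U : ℝ) : ℂ) * ((midLower ρ β U : ℝ) : ℂ) *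
      ((plaqObs ρ (tiltedUnit d i j (2 * P) (2 * P) L) (y, q) U : ℝ) : ℂ))
      (productHaar (TiltedSite d i j (2 * P) (2 * P) L) d G) :=
    fun x y => TwistedSlab.integrable_config_of_continuous ((hfc x).mul (hWc y))
  -- the slab step with the frozen factor `W_x · B`
  have hst := fun x y (hx : axisCoord d L (2 * P) x = ((P : ℕ) : ZMod (2 * P)))
      (hy : axisCoord d L (2 * P) y = ((P : ℕ) : ZMod (2 * P))) =>
    SquareSlab.slab_step ρ q hq1 hq2 he1 he2 hρ hc _ (hfc x) (hfdep x hx) y hy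
  have hB : ∫ U, ((midDiff ρ q (configMidReflect (tiltedUnit d i j (2 * P) (2 * P) L) i
          (tiltedAxisFlip d L (2 * P) hij) U) : ℝ) : ℂ) * ((midDiff ρ q U : ℝ) : ℂ) *
          (((midLower ρ β U : ℝ) : ℂ) * ∏ t ∈ SquareSlab.block d i j L (2 * P) ((P : ℕ) : ZMod (2 * P)),
            (TwistedSlab.wilsonWeight ρ β (SquareSlab.frozenA ((P : ℕ) : ZMod (2 * P)) t U * (U t)⁻¹ *
              SquareSlab.frozenB ((P : ℕ) : ZMod (2 * P)) t U) : ℂ))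
          ∂(productHaar (TiltedSite d i j (2 * P) (2 * P) L) d G) =
      -((∫ k, (TwistedSlab.wilsonWeight ρ β k : ℂ) ∂(haarProbability G)) ^
          ((SquareSlab.block d i j L (2 * P) ((P : ℕ) : ZMod (2 * P))).card - 4) * (c : ℂ) ^ 4) *
        ((∫ U, midLower ρ β U * midDiff ρ q U ^ 2 ∂(productHaar (TiltedSite d i j (2 * P) (2 * P) L) d G) : ℝ) : ℂ) := by
    -- expand: four terms `(W_x B) · W_{y + e_i} · ∏`
    have hpt : ∀ U : Config (TiltedSite d i j (2 * P) (2 * P) L) d G,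
        ((midDiff ρ q (configMidReflect (tiltedUnit d i j (2 * P) (2 * P) L) i
          (tiltedAxisFlip d L (2 * P) hij) U) : ℝ) : ℂ) * ((midDiff ρ q U : ℝ) : ℂ) *
          (((midLower ρ β U : ℝ) : ℂ) * ∏ t ∈ SquareSlab.block d i j L (2 * P) ((P : ℕ) : ZMod (2 * P)),
            (TwistedSlab.wilsonWeight ρ β (SquareSlab.frozenA ((P : ℕ) : ZMod (2 * P)) t U * (U t)⁻¹ *
              SquareSlab.frozenB ((P : ℕ) : ZMod (2 * P)) t U) : ℂ)) =
        ((plaqObs ρ (tiltedUnit d i j (2 * P) (2 * P) L) (layerSite d L P, q) U : ℝ) : ℂ) *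
            ((midLower ρ β U : ℝ) : ℂ) *
            ((plaqObs ρ (tiltedUnit d i j (2 * P) (2 * P) L)
              (layerSite d L P + tiltedTwist d L (2 * P) + tiltedUnit d i j (2 * P) (2 * P) L i, q) U : ℝ) : ℂ) *
            ∏ t ∈ SquareSlab.block d i j L (2 * P) ((P : ℕ) : ZMod (2 * P)),
              (TwistedSlab.wilsonWeight ρ β (SquareSlab.frozenA ((P : ℕ) : ZMod (2 * P)) t U * (U t)⁻¹ *
                SquareSlab.frozenB ((P : ℕ) : ZMod (2 * P)) t U) : ℂ) -
          ((plaqObs ρ (tiltedUnit d i j (2 * P) (2 * P) L) (layerSite d L P + tiltedTwist d L (2 * P), q) U : ℝ) : ℂ) *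
            ((midLower ρ β U : ℝ) : ℂ) *
            ((plaqObs ρ (tiltedUnit d i j (2 * P) (2 * P) L)
              (layerSite d L P + tiltedTwist d L (2 * P) + tiltedUnit d i j (2 * P) (2 * P) L i, q) U : ℝ) : ℂ) *
            ∏ t ∈ SquareSlab.block d i j L (2 * P) ((P : ℕ) : ZMod (2 * P)),
              (TwistedSlab.wilsonWeight ρ β (SquareSlab.frozenA ((P : ℕ) : ZMod (2 * P)) t U * (U t)⁻¹ *
                SquareSlab.frozenB ((P : ℕ) : ZMod (2 * P)) t U) : ℂ) -
          ((plaqObs ρ (tiltedUnit d i j (2 * P) (2 * P) L) (layerSite d L P, q) U : ℝ) : ℂ) *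
            ((midLower ρ β U : ℝ) : ℂ) *
            ((plaqObs ρ (tiltedUnit d i j (2 * P) (2 * P) L)
              (layerSite d L P + tiltedUnit d i j (2 * P) (2 * P) L i, q) U : ℝ) : ℂ) *
            ∏ t ∈ SquareSlab.block d i j L (2 * P) ((P : ℕ) : ZMod (2 * P)),
              (TwistedSlab.wilsonWeight ρ β (SquareSlab.frozenA ((P : ℕ) : ZMod (2 * P)) t U * (U t)⁻¹ *
                SquareSlab.frozenB ((P : ℕ) : ZMod (2 * P)) t U) : ℂ) +
          ((plaqObs ρ (tiltedUnit d i j (2 * P) (2 * P) L) (layerSite d L P + tiltedTwist d L (2 * P), q) U : ℝ) : ℂ) *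
            ((midLower ρ β U : ℝ) : ℂ) *
            ((plaqObs ρ (tiltedUnit d i j (2 * P) (2 * P) L)
              (layerSite d L P + tiltedUnit d i j (2 * P) (2 * P) L i, q) U : ℝ) : ℂ) *
            ∏ t ∈ SquareSlab.block d i j L (2 * P) ((P : ℕ) : ZMod (2 * P)),
              (TwistedSlab.wilsonWeight ρ β (SquareSlab.frozenA ((P : ℕ) : ZMod (2 * P)) t U * (U t)⁻¹ *
                SquareSlab.frozenB ((P : ℕ) : ZMod (2 * P)) t U) : ℂ) := by
      intro U
      rw [midDiff_configMidReflect ρ q hij hq1 hq2 hρ U, midDiff]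
      push_cast
      ring
    simp_rw [hpt]
    rw [integral_sub_sub_add (hI3 _ _) (hI3 _ _) (hI3 _ _) (hI3 _ _),
      hst _ _ hx0 hxT, hst _ _ hxT hxT, hst _ _ hx0 hx0, hst _ _ hxT hx0]
    -- `∫ B D² = J(y₀,y₀) - J(y₀,y₀+T) - J(y₀+T,y₀) + J(y₀+T,y₀+T)`, `J(x,y) = ∫ W_x B W_y`
    have hD2 : ((∫ U, midLower ρ β U * midDiff ρ q U ^ 2 ∂(productHaar (TiltedSite d i j (2 * P) (2 * P) L) d G) : ℝ) : ℂ) =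
        ∫ U, ((plaqObs ρ (tiltedUnit d i j (2 * P) (2 * P) L) (layerSite d L P, q) U : ℝ) : ℂ) *
              ((midLower ρ β U : ℝ) : ℂ) *
              ((plaqObs ρ (tiltedUnit d i j (2 * P) (2 * P) L) (layerSite d L P, q) U : ℝ) : ℂ)
            ∂(productHaar (TiltedSite d i j (2 * P) (2 * P) L) d G) -
          ∫ U, ((plaqObs ρ (tiltedUnit d i j (2 * P) (2 * P) L) (layerSite d L P, q) U : ℝ) : ℂ) *
              ((midLower ρ β U : ℝ) : ℂ) *
              ((plaqObs ρ (tiltedUnit d i j (2 * P) (2 * P) L) (layerSite d L P + tiltedTwist d L (2 * P), q) U : ℝ) : ℂ)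
            ∂(productHaar (TiltedSite d i j (2 * P) (2 * P) L) d G) -
          ∫ U, ((plaqObs ρ (tiltedUnit d i j (2 * P) (2 * P) L) (layerSite d L P + tiltedTwist d L (2 * P), q) U : ℝ) : ℂ) *
              ((midLower ρ β U : ℝ) : ℂ) *
              ((plaqObs ρ (tiltedUnit d i j (2 * P) (2 * P) L) (layerSite d L P, q) U : ℝ) : ℂ)
            ∂(productHaar (TiltedSite d i j (2 * P) (2 * P) L) d G) +
          ∫ U, ((plaqObs ρ (tiltedUnit d i j (2 * P) (2 * P) L) (layerSite d L P + tiltedTwist d L (2 * P), q) U : ℝ) : ℂ) *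
              ((midLower ρ β U : ℝ) : ℂ) *
              ((plaqObs ρ (tiltedUnit d i j (2 * P) (2 * P) L) (layerSite d L P + tiltedTwist d L (2 * P), q) U : ℝ) : ℂ)
            ∂(productHaar (TiltedSite d i j (2 * P) (2 * P) L) d G) := by
      rw [← integral_complex_ofReal, ← integral_sub_sub_add (hI2 _ _) (hI2 _ _) (hI2 _ _) (hI2 _ _)]
      refine integral_congr_ae (ae_of_all _ fun U => ?_)
      simp only [midDiff]
      push_cast
      ring
    rw [hD2]
    ring
  -- Step C: the sign
  rw [hA, hB, hzr]
  have hκ : 0 < (∫ k, TwistedSlab.wilsonWeight ρ β k ∂(haarProbability G)) ^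
      ((SquareSlab.block d i j L (2 * P) ((P : ℕ) : ZMod (2 * P))).card - 4) * c ^ 4 :=
    mul_pos (pow_pos hzpos _) (pow_pos hcpos 4)
  have hfin : C₀ / Z * (-((∫ k, TwistedSlab.wilsonWeight ρ β k ∂(haarProbability G)) ^
      ((SquareSlab.block d i j L (2 * P) ((P : ℕ) : ZMod (2 * P))).card - 4) * c ^ 4) *
      ∫ U, midLower ρ β U * midDiff ρ q U ^ 2 ∂(productHaar (TiltedSite d i j (2 * P) (2 * P) L) d G)) < 0 :=
    mul_neg_of_pos_of_neg (div_pos hC₀pos hZ) (mul_neg_of_neg_of_pos (neg_neg_of_pos hκ) hsq)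
  have hcast := Complex.real_lt_real.2 hfin
  push_cast at hcast; simpa using hcast

/-! ## The corollary for `d ≥ 3` -/

/-- **Corollary: closed-half LINK reflection positivity, in the shape of `tiltedBox_linkRP`, is
FALSE along the axis `i` of the square tilted box of even side `2P` (`P ≥ 2`), in `d ≥ 3`
(a direction `k ∉ {i, j}`), with `L ≥ 2`, for every `β > 0`** — `G` compact second countable, `ρ`
continuous, non-trivial, with scalar commutant, `N ≥ 1`. With `not_tiltedBox_axisRP` (even side,
site mirror) and `not_tiltedBox_axisRP_odd` (odd side): no in-plane mirror of a square tilted box,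
through sites or through links, gives a PSD block in `d ≥ 3`. -/
theorem not_tiltedBox_midAxisRP (hP : 2 ≤ P) (hij : i ≠ j) {k : Fin d} (hki : k ≠ i) (hkj : k ≠ j)
    (hL : 2 ≤ L) (hρ : Continuous ρ) (hirr : TwistedSlab.HasScalarCommutant ρ) (hN : 1 ≤ N)
    (hρ1 : ∃ g, ρ g ≠ 1) {β : ℝ} (hβ : 0 < β) :
    ¬ ∀ F : Config (TiltedSite d i j (2 * P) (2 * P) L) d G → ℂ, Measurable F →
        (∃ C : ℝ, ∀ U, ‖F U‖ ≤ C) →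
        IsMidObservable (tiltedUnit d i j (2 * P) (2 * P) L) P (axisCoord d L (2 * P)) F →
        0 ≤ ∫ U, conj (F (configMidReflect (tiltedUnit d i j (2 * P) (2 * P) L) i
          (tiltedAxisFlip d L (2 * P) hij) U)) * F U
          ∂(gibbs ρ (tiltedUnit d i j (2 * P) (2 * P) L) β) := by
  intro hRP
  -- the transverse direction pair `{j, k}`
  have hq : ∃ q : DirPair d, q.1.1 ≠ i ∧ q.1.2 ≠ i ∧
      tiltedUnit d i j (2 * P) (2 * P) L q.1.1 ≠ 0 ∧ tiltedUnit d i j (2 * P) (2 * P) L q.1.2 ≠ 0 := by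
    by_cases hjk : j < k
    · exact ⟨⟨(j, k), hjk⟩, hij.symm, hki, SquareBox.tiltedUnit_right_ne_zero hij,
        SquareBox.tiltedUnit_other_ne_zero hki hkj hL⟩
    · exact ⟨⟨(k, j), lt_of_le_of_ne (not_lt.1 hjk) hkj⟩, hki, hij.symm,
        SquareBox.tiltedUnit_other_ne_zero hki hkj hL, SquareBox.tiltedUnit_right_ne_zero hij⟩
  obtain ⟨q, hq1, hq2, he1, he2⟩ := hq
  obtain ⟨F, hFm, hFb, hFo, hneg⟩ :=
    tiltedBox_midAxisRP_neg (L := L) (P := P) ρ q hP hij hq1 hq2 he1 he2 hρ hirr hN hρ1 hβ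
  exact lt_irrefl _ (lt_of_le_of_lt (hRP F hFm hFb hFo) hneg)

end Main

/-! ## The negatives for `SU(N)` and `U(N)` -/

section Groups

variable {d : ℕ} {i j k : Fin d} {L P N : ℕ} [NeZero L] [NeZero P]

/-- **In-plane link RP fails on the even square tilted box for `SU(N)` lattice Yang–Mills**: box
`ℤ^d/Γ(2P, 2P, L)`, `P ≥ 2`, `L ≥ 2`, `k ∉ {i, j}` (`d ≥ 3`), fundamental representation, `N ≥ 2`,
every `β > 0`. [folklore] -/
theorem not_tiltedBox_midAxisRP_suN (hP : 2 ≤ P) (hij : i ≠ j) (hki : k ≠ i) (hkj : k ≠ j) (hL : 2 ≤ L)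
    (hN : 2 ≤ N) {β : ℝ} (hβ : 0 < β) :
    ¬ ∀ F : Config (TiltedSite d i j (2 * P) (2 * P) L) d (Matrix.specialUnitaryGroup (Fin N) ℂ) → ℂ,
        Measurable F → (∃ C : ℝ, ∀ U, ‖F U‖ ≤ C) →
        IsMidObservable (tiltedUnit d i j (2 * P) (2 * P) L) P (axisCoord d L (2 * P)) F →
        0 ≤ ∫ U, conj (F (configMidReflect (tiltedUnit d i j (2 * P) (2 * P) L) i
          (tiltedAxisFlip d L (2 * P) hij) U)) * F U
          ∂(gibbs (fundamentalRep (Fin N)) (tiltedUnit d i j (2 * P) (2 * P) L) β) := by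
  haveI : SecondCountableTopology (Matrix (Fin N) (Fin N) ℂ) :=
    inferInstanceAs (SecondCountableTopology (Fin N → Fin N → ℂ))
  haveI : SecondCountableTopology (Matrix.specialUnitaryGroup (Fin N) ℂ) :=
    Topology.IsEmbedding.subtypeVal.secondCountableTopology
  exact not_tiltedBox_midAxisRP (fundamentalRep (Fin N)) hP hij hki hkj hL (continuous_fundamentalRep (Fin N))
    hasScalarCommutant_fundamentalRep (by omega) (exists_fundamentalRep_ne_one hN) hβ

/-- **In-plane link RP fails on the even square tilted box for `U(N)` lattice gauge theory**
(`N ≥ 1`, every `β > 0`; same box hypotheses). [folklore] -/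
theorem not_tiltedBox_midAxisRP_uN (hP : 2 ≤ P) (hij : i ≠ j) (hki : k ≠ i) (hkj : k ≠ j) (hL : 2 ≤ L)
    (hN : 1 ≤ N) {β : ℝ} (hβ : 0 < β) :
    ¬ ∀ F : Config (TiltedSite d i j (2 * P) (2 * P) L) d (Matrix.unitaryGroup (Fin N) ℂ) → ℂ,
        Measurable F → (∃ C : ℝ, ∀ U, ‖F U‖ ≤ C) →
        IsMidObservable (tiltedUnit d i j (2 * P) (2 * P) L) P (axisCoord d L (2 * P)) F →
        0 ≤ ∫ U, conj (F (configMidReflect (tiltedUnit d i j (2 * P) (2 * P) L) i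
          (tiltedAxisFlip d L (2 * P) hij) U)) * F U
          ∂(gibbs (unitaryFundamentalRep (Fin N) ℂ) (tiltedUnit d i j (2 * P) (2 * P) L) β) := by
  haveI : SecondCountableTopology (Matrix (Fin N) (Fin N) ℂ) :=
    inferInstanceAs (SecondCountableTopology (Fin N → Fin N → ℂ))
  haveI : SecondCountableTopology (Matrix.unitaryGroup (Fin N) ℂ) :=
    Topology.IsEmbedding.subtypeVal.secondCountableTopology
  exact not_tiltedBox_midAxisRP (unitaryFundamentalRep (Fin N) ℂ) hP hij hki hkj hL
    (continuous_unitaryFundamentalRep (n := Fin N) (𝕜 := ℂ)) hasScalarCommutant_unitaryFundamentalRep hN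
    (exists_unitaryFundamentalRep_ne_one hN) hβ

end Groups

end TiltedRP

end Summit.QuantumFields.GaugeBoot

end
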